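import Summits.Ventures.CertifiedManyBodySolver.Observables.PhaseSeparationExclusionBoxThermalHotAnchor
import Summits.Ventures.CertifiedManyBodySolver.Observables.PhaseSeparationExclusionBoxGrandCanonicalThermalFreeDilute
import Summits.Ventures.CertifiedManyBodySolver.Observables.PhaseSeparationExclusionBoxGrandCanonicalThermalGap
import Summits.Ventures.CertifiedManyBodySolver.Observables.PhaseSeparationExclusionPeriodicPhasesCells
import Literature.MathematicalPhysics.QuantumLattice.HubbardTTPrimeSourcedParticleHole
import Literature.MathematicalPhysics.QuantumLattice.HubbardTTPrimeThermalPressureParticleHole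
import Literature.MathematicalPhysics.QuantumLattice.HubbardNNNHoppingEnergyDensityParticleHole
import Literature.MathematicalPhysics.QuantumLattice.HubbardEnergyDensityChemicalPotential
import HarnessLib

/-!
# Ventures/CertifiedManyBodySolver — Observables/PhaseSeparationExclusionParticleHole.lean: THE PARTICLE–HOLE TRANSPORT of the
# competing-order (phase-separation-exclusion) words — `(t′, n) ↦ (−t′, 2 − n)`: a word «(≤ n₁ ∣ ≥ n₂)» on a cell `[s₁, s₂] × [U₁, U₂]`
# IS the word «(≤ 2 − n₂ ∣ ≥ 2 − n₁)» on the mirrored cell `[−s₂, −s₁] × [U₁, U₂]`; `T = 0` (states), `T > 0` and the `μ` axis (bundles)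

HONEST FRAMING: first certified bounds; not a superconductivity verdict. CLASS = TRANSPORT (generic, sorry-free theorems; no claim
node, no number, no definition). WHY: an ELECTRON-DOPED one-band box (Nd₂₋ₓCeₓCuO₄ / PCCO / LCCO: router `t′/t ∈ [−0.29, −0.19]`,
`U/t ∈ [2.7, 3.4]`, filling `n = 1 + x > 1`) sits at `t′ < 0`, `n > 1`; its certified energy rows live — by the particle–hole symmetry of
the square-lattice `t–t′` Hubbard model, `c_{xσ} ↦ (−1)^{x₁+x₂} c†_{xσ}`: `H(t, t′, U) ↦ H(t, −t′, U) − UN + U|Λ|` — at `(−t′ > 0, 2 − n < 1)`,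
where the tree's words were typed (`…MidSegmentCapWeakCouplingElectronDoped{,B,C,Axes}.lean`, g27, «stated AT `t′ ≥ 0` in the standard
(≤ n₁ ∣ ≥ 1) form; state-level p–h transport not typed»). This file types the transport once, generically:

* §1 `T = 0`, SENTENCE LEVEL (states): `ps_not_groundState_mix_particleHole` — if at `(t, s, U)` no mixture of translation-invariant
  states of densities `≤ n₁` and `≥ n₂` is a ground state (the tree's sentence, as a hypothesis), then at `(t, −s, U)` no mixture of
  translation-invariant states of densities `≤ 2 − n₂` and `≥ 2 − n₁` is one. Proof: the state map `ω ↦ ω ∘ α` (`InfVolFermionState.particleHole`: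
  affine `particleHole_mix`, `ρ(ω ∘ α) = 2 − ρ(ω)` `density_particleHole`, translation invariance kept `IsTranslationInvariant.particleHole` —
  translation-invariant states are even), the mean-energy identity `e^{t,s,U}(ω ∘ α) = e^{t,−s,U}(ω) + U(1 − ρ(ω))`
  (`IsTranslationInvariant.meanEnergy_hubbardTTPrime_particleHole`) and the ground-state-energy identity `e(t, −s, U, n) = e(t, s, U, 2 − n) + U(n − 1)`
  (`energyDensityTT'_particleHole'`): the two affine terms are the same. Cell form `…_on_cell` (`s ∈ [−s₂, −s₁] ↔ −s ∈ [s₁, s₂]`) and the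
  PERIODIC-components twin `ps_periodic_not_groundState_mix_particleHole` (stripes / Néel states as components, via
  `IsPeriodic.energyDensityTT'_lt_cellEnergy_mix_of_forall_isTranslationInvariant_thresholds`).
* §2 BUNDLE LEVEL (functions): the cell data every law of this directory consumes — a cap `C` at the mean density `a n₁ + b n₂`, floors
  `F₁, F₂` at `n₁, n₂`, pressure ceilings `p(β_h; n_i) ≤ P_i` — is transported to the mirrored cell for the pair `(2 − n₂, 2 − n₁)` with
  weights `(b, a)`: `reflected_cap`, `reflected_floor`, `reflected_anchor` (`pressureTT'_particleHole`: `p(β; t, s, U; 2 − m) = βU(m − 1) + p(β; t, −s, U; m)`).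
  The `T = 0` margin `aF₁ + bF₂ − C` and the anchored combination `aP₁ + bP₂ + β_{h,1}aF₁ + β_{h,2}bF₂` are INVARIANT (the affine terms cancel;
  `a + b = 1`), so every threshold / gap transports verbatim.
* §3 REFLECTED LAWS (source hypotheses, mirrored conclusion): `ps_not_groundState_mix_on_cell_of_fns_reflected` (`T = 0`),
  `psT_not_thermal_mix_on_cell_of_fns_reflected` (`T > 0`, `2 log 2`), `psT_not_thermal_mix_on_cell_of_fns_hotAnchorFn_reflected` (`T > 0`, anchors),
  `psGC_gap_on_cell_of_fns_reflected` (`μ` axis `T = 0`: the SAME gap `a·b·(n₂ − n₁)·Δμ ≥ g`), `psGCT_not_equilibrium_on_cell_of_fns_hotAnchorFn_reflected`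
  and `psGCT_gap_on_cell_of_fns_hotAnchorFn_reflected` (`μ` axis `T > 0`).
Instances: `Observables/PhaseSeparationExclusionElectronDopedBox.lean` (the NCCO-type box on its own `t′ < 0` cell).
NOT done here: the `T > 0` transport at STATE level (torus limits of sector Gibbs states under the torus unitary — the sector counts at `n` and
`2 − n` need not be complementary at finite `L`; the bundle route is exact and sufficient); Zeeman / layered column forms.
Cell `pub/hubbard-downfold` (MO-S1 ↔ S2 seam «box ↦ one word», filling direction), seat `hubbard-downfold-unc-2` (g28), 2026-08-29. Zero kit.
References: E. H. Lieb, PRL 62 (1989) 1201, proof of Thm 2 [LiebPRL1989]; E. H. Lieb, F. Y. Wu, Physica A 321 (2003) 1, §1 eq. (3) [LiebWuPhysicaA2003];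
H. Tasaki, *Physics and Mathematics of Quantum Many-Body Systems* (2020) §9.3.3 [Tasaki2020]; R. B. Israel, *Convexity in the Theory of Lattice
Gases* (1979) Thm I.2.4 [Israel1979]; V. J. Emery, S. A. Kivelson, H. Q. Lin, PRL 64 (1990) 475 [EmeryKivelsonLin1990]; D. Ruelle (1969) §3.3–3.4 [Ruelle1969].
-/

noncomputable section

namespace Summit.Ventures.CertifiedManyBodySolver.Observables

open Literature.MathematicalPhysics.QuantumLattice Literature.MathematicalPhysics.QuantumLattice.ThermodynamicLimit
open Literature.MathematicalPhysics.QuantumLattice.InfVolFermionState Set Filter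

/-! ## §1 `T = 0`: the sentence-level transport through the state map `ω ↦ ω ∘ α` -/

/-- Mixtures are symmetric: `λω₁ + (1−λ)ω₂ = (1−λ)ω₂ + λω₁` (same local expectations). [cite: BratteliRobinsonI1987, §4.3.1] -/
private theorem mix_symm (lam : ℝ) (h0 : 0 ≤ lam) (h1 : lam ≤ 1) (ω₁ ω₂ : InfVolFermionState 2) :
    mix lam h0 h1 ω₁ ω₂ = mix (1 - lam) (sub_nonneg.2 h1) (sub_le_self 1 h0) ω₂ ω₁ := by
  refine InfVolFermionState.ext fun Λ => LinearMap.ext fun A => ?_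
  rw [mix_expect, mix_expect]
  push_cast
  ring

/-- **PARTICLE–HOLE TRANSPORT OF THE `T = 0` COMPETING-ORDER SENTENCE (state level).** If at `(t, s, U)` (`U ≥ 0`) every mixture
`λω₁ + (1−λ)ω₂` (`0 < λ < 1`) of translation-invariant states with `0 < ρ(ω₁) ≤ n₁`, `n₂ ≤ ρ(ω₂) < 2` has mean energy STRICTLY above
`e(t, s, U, ·)` at its density (the tree's «(≤ n₁ ∣ ≥ n₂)» sentence), then at `(t, −s, U)` the same holds for the pair «(≤ 2 − n₂ ∣ ≥ 2 − n₁)»: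
apply the sentence to the particle–hole transforms `ω₂ ∘ α`, `ω₁ ∘ α` (translation invariant, densities `2 − ρ`), whose mixture is
`(λω₁ + (1−λ)ω₂) ∘ α`, and use `e^{t,s,U}(ω ∘ α) = e^{t,−s,U}(ω) + U(1 − ρ(ω))`, `e(t, s, U, 2 − ρ) = e(t, −s, U, ρ) + U(1 − ρ)`.
[cite: LiebPRL1989, proof of Theorem 2] [cite: LiebWuPhysicaA2003, §1 eq. (3)] [cite: Israel1979, Thm. I.2.4] -/
theorem ps_not_groundState_mix_particleHole (t s : ℝ) {U n₁ n₂ : ℝ} (hU : 0 ≤ U)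
    (hPS : ∀ ⦃ω₁ ω₂ : InfVolFermionState 2⦄, ω₁.IsTranslationInvariant → ω₂.IsTranslationInvariant →
      0 < ω₁.density → ω₁.density ≤ n₁ → n₂ ≤ ω₂.density → ω₂.density < 2 → ∀ ⦃lam : ℝ⦄ (hl0 : 0 < lam) (hl1 : lam < 1),
      energyDensityTT' t s U (mix lam hl0.le hl1.le ω₁ ω₂).density <
        (mix lam hl0.le hl1.le ω₁ ω₂).meanEnergy (hubbardTTPrimeFermionInteraction t s U) 1)
    {ω₁ ω₂ : InfVolFermionState 2} (h₁ : ω₁.IsTranslationInvariant) (h₂ : ω₂.IsTranslationInvariant)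
    (hρ₁ : 0 < ω₁.density) (hρ₁' : ω₁.density ≤ 2 - n₂) (hρ₂ : 2 - n₁ ≤ ω₂.density) (hρ₂' : ω₂.density < 2)
    {lam : ℝ} (hl0 : 0 < lam) (hl1 : lam < 1) :
    energyDensityTT' t (-s) U (mix lam hl0.le hl1.le ω₁ ω₂).density <
      (mix lam hl0.le hl1.le ω₁ ω₂).meanEnergy (hubbardTTPrimeFermionInteraction t (-s) U) 1 := by
  have hM : (mix lam hl0.le hl1.le ω₁ ω₂).IsTranslationInvariant := h₁.mix h₂ lam hl0.le hl1.le
  have hα₁ : ω₁.particleHole.IsTranslationInvariant := h₁.particleHole (h₁.isEven two_pos)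
  have hα₂ : ω₂.particleHole.IsTranslationInvariant := h₂.particleHole (h₂.isEven two_pos)
  have hd₁ : ω₁.particleHole.density = 2 - ω₁.density := density_particleHole ω₁
  have hd₂ : ω₂.particleHole.density = 2 - ω₂.density := density_particleHole ω₂
  have h1l : 0 < 1 - lam := sub_pos.2 hl1
  have h1l' : 1 - lam < 1 := sub_lt_self 1 hl0
  have key := hPS hα₂ hα₁ (by rw [hd₂]; linarith) (by rw [hd₂]; linarith) (by rw [hd₁]; linarith)
    (by rw [hd₁]; linarith) h1l h1l'
  have hmix : mix (1 - lam) h1l.le h1l'.le ω₂.particleHole ω₁.particleHole =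
      (mix lam hl0.le hl1.le ω₁ ω₂).particleHole := by
    rw [particleHole_mix, mix_symm lam hl0.le hl1.le]
  rw [hmix, density_particleHole, hM.meanEnergy_hubbardTTPrime_particleHole t s U] at key
  have hρ0 : 0 < (mix lam hl0.le hl1.le ω₁ ω₂).density := by
    rw [density_mix]; nlinarith [density_nonneg ω₂]
  have hρ2 : (mix lam hl0.le hl1.le ω₁ ω₂).density < 2 := by
    rw [density_mix]; nlinarith [density_le_two ω₁]
  rw [energyDensityTT'_particleHole' t s hU hρ0 hρ2]
  linarith

/-- **CELL FORM of the `T = 0` transport**: the «(≤ n₁ ∣ ≥ n₂)» sentence on `[s₁, s₂] × [U₁, U₂]` (`U₁ ≥ 0`) gives the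
«(≤ 2 − n₂ ∣ ≥ 2 − n₁)» sentence on the mirrored cell `[−s₂, −s₁] × [U₁, U₂]`. [cite: LiebWuPhysicaA2003, §1 eq. (3)] [cite: Israel1979, Thm. I.2.4] -/
theorem ps_not_groundState_mix_particleHole_on_cell (t : ℝ) {s₁ s₂ U₁ U₂ n₁ n₂ : ℝ} (hU₁ : 0 ≤ U₁)
    (hPS : ∀ s ∈ Icc s₁ s₂, ∀ U ∈ Icc U₁ U₂, ∀ ⦃ω₁ ω₂ : InfVolFermionState 2⦄, ω₁.IsTranslationInvariant →
      ω₂.IsTranslationInvariant → 0 < ω₁.density → ω₁.density ≤ n₁ → n₂ ≤ ω₂.density → ω₂.density < 2 →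
      ∀ ⦃lam : ℝ⦄ (hl0 : 0 < lam) (hl1 : lam < 1),
      energyDensityTT' t s U (mix lam hl0.le hl1.le ω₁ ω₂).density <
        (mix lam hl0.le hl1.le ω₁ ω₂).meanEnergy (hubbardTTPrimeFermionInteraction t s U) 1)
    {s : ℝ} (hs : s ∈ Icc (-s₂) (-s₁)) {U : ℝ} (hU : U ∈ Icc U₁ U₂)
    {ω₁ ω₂ : InfVolFermionState 2} (h₁ : ω₁.IsTranslationInvariant) (h₂ : ω₂.IsTranslationInvariant)
    (hρ₁ : 0 < ω₁.density) (hρ₁' : ω₁.density ≤ 2 - n₂) (hρ₂ : 2 - n₁ ≤ ω₂.density) (hρ₂' : ω₂.density < 2)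
    {lam : ℝ} (hl0 : 0 < lam) (hl1 : lam < 1) :
    energyDensityTT' t s U (mix lam hl0.le hl1.le ω₁ ω₂).density <
      (mix lam hl0.le hl1.le ω₁ ω₂).meanEnergy (hubbardTTPrimeFermionInteraction t s U) 1 := by
  have hs' : -s ∈ Icc s₁ s₂ := ⟨by linarith [hs.2], by linarith [hs.1]⟩
  have h := ps_not_groundState_mix_particleHole t (-s) (hU₁.trans hU.1) (hPS (-s) hs' U hU) h₁ h₂ hρ₁ hρ₁' hρ₂ hρ₂' hl0 hl1
  rwa [neg_neg] at h

/-- **PERIODIC-COMPONENTS TWIN of the transport**: from the translation-invariant «(≤ n₁ ∣ ≥ n₂)» sentence at `(t, s, U)`, at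
`(t, −s, U)` no mixture of two `q`-PERIODIC states (stripes, Néel / density waves — any common period lattice) of cell fillings
`0 < ρ̄(ω₁) ≤ 2 − n₂`, `2 − n₁ ≤ ρ̄(ω₂) < 2` is a ground state. [cite: LiebWuPhysicaA2003, §1 eq. (3)] [cite: Israel1979, Thm. I.2.4] [cite: BratteliRobinsonI1987, §4.3.1] -/
theorem ps_periodic_not_groundState_mix_particleHole (t s : ℝ) {U n₁ n₂ : ℝ} (hU : 0 ≤ U)
    (hPS : ∀ ⦃ω₁ ω₂ : InfVolFermionState 2⦄, ω₁.IsTranslationInvariant → ω₂.IsTranslationInvariant →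
      0 < ω₁.density → ω₁.density ≤ n₁ → n₂ ≤ ω₂.density → ω₂.density < 2 → ∀ ⦃lam : ℝ⦄ (hl0 : 0 < lam) (hl1 : lam < 1),
      energyDensityTT' t s U (mix lam hl0.le hl1.le ω₁ ω₂).density <
        (mix lam hl0.le hl1.le ω₁ ω₂).meanEnergy (hubbardTTPrimeFermionInteraction t s U) 1)
    {q : Fin 2 → ℕ} {ω₁ ω₂ : InfVolFermionState 2} (h₁ : ω₁.IsPeriodic q) (h₂ : ω₂.IsPeriodic q)
    (hρ₁ : 0 < ω₁.cellFilling q) (hρ₁' : ω₁.cellFilling q ≤ 2 - n₂) (hρ₂ : 2 - n₁ ≤ ω₂.cellFilling q)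
    (hρ₂' : ω₂.cellFilling q < 2) {lam : ℝ} (hl0 : 0 < lam) (hl1 : lam < 1) :
    energyDensityTT' t (-s) U ((mix lam hl0.le hl1.le ω₁ ω₂).cellFilling q) <
      (mix lam hl0.le hl1.le ω₁ ω₂).cellEnergy (fun _ : Cell q => hubbardTTPrimeFermionInteraction t (-s) U) 1 :=
  IsPeriodic.energyDensityTT'_lt_cellEnergy_mix_of_forall_isTranslationInvariant_thresholds t (-s) U
    (fun _ _ k₁ k₂ a' b' c' e' _ hl0' hl1' =>
      ps_not_groundState_mix_particleHole t s hU hPS k₁ k₂ a' b' c' e' hl0' hl1')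
    h₁ h₂ hρ₁ hρ₁' hρ₂ hρ₂' hl0 hl1

/-! ## §2 Bundle level: caps, floors and pressure anchors through `(s, n) ↦ (−s, 2 − n)` -/

/-- `s ∈ [−s₂, −s₁] ⇒ −s ∈ [s₁, s₂]`. [folklore] -/
theorem neg_mem_Icc_of_mem_Icc_neg {s s₁ s₂ : ℝ} (hs : s ∈ Icc (-s₂) (-s₁)) : -s ∈ Icc s₁ s₂ :=
  ⟨by linarith [hs.2], by linarith [hs.1]⟩

/-- **REFLECTED CAP.** A cap `e(t, s, U, a n₁ + b n₂) ≤ C(s, U)` on `[s₁, s₂] × [U₁, U₂]` (`U₁ ≥ 0`, `a + b = 1`, `0 < a n₁ + b n₂ < 2`) is the cap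
`e(t, s, U, b(2 − n₂) + a(2 − n₁)) ≤ C(−s, U) + U·(b(2 − n₂) + a(2 − n₁) − 1)` on `[−s₂, −s₁] × [U₁, U₂]`. [cite: LiebWuPhysicaA2003, §1 eq. (3)] -/
theorem reflected_cap (t : ℝ) {s₁ s₂ U₁ U₂ n₁ n₂ a b : ℝ} (hU₁ : 0 ≤ U₁) (hab : a + b = 1)
    (hm0 : 0 < a * n₁ + b * n₂) (hm2 : a * n₁ + b * n₂ < 2) {C : ℝ → ℝ → ℝ}
    (hC : ∀ s ∈ Icc s₁ s₂, ∀ U ∈ Icc U₁ U₂, energyDensityTT' t s U (a * n₁ + b * n₂) ≤ C s U) :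
    ∀ s ∈ Icc (-s₂) (-s₁), ∀ U ∈ Icc U₁ U₂,
      energyDensityTT' t s U (b * (2 - n₂) + a * (2 - n₁)) ≤ C (-s) U + U * (b * (2 - n₂) + a * (2 - n₁) - 1) := by
  intro s hs U hU
  have hd : b * (2 - n₂) + a * (2 - n₁) = 2 - (a * n₁ + b * n₂) := by linear_combination (2 : ℝ) * hab
  have h := hC (-s) (neg_mem_Icc_of_mem_Icc_neg hs) U hU
  rw [hd, energyDensityTT'_particleHole t s (hU₁.trans hU.1) (n := 2 - (a * n₁ + b * n₂)) (by linarith) (by linarith),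
    sub_sub_cancel]
  linarith

/-- **REFLECTED FLOOR.** A floor `F(s, U) ≤ e(t, s, U, m)` on `[s₁, s₂] × [U₁, U₂]` (`U₁ ≥ 0`, `0 < m < 2`) is the floor
`F(−s, U) + U·(1 − m) ≤ e(t, s, U, 2 − m)` on `[−s₂, −s₁] × [U₁, U₂]`. [cite: LiebWuPhysicaA2003, §1 eq. (3)] -/
theorem reflected_floor (t : ℝ) {s₁ s₂ U₁ U₂ m : ℝ} (hU₁ : 0 ≤ U₁) (hm0 : 0 < m) (hm2 : m < 2) {F : ℝ → ℝ → ℝ}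
    (hF : ∀ s ∈ Icc s₁ s₂, ∀ U ∈ Icc U₁ U₂, F s U ≤ energyDensityTT' t s U m) :
    ∀ s ∈ Icc (-s₂) (-s₁), ∀ U ∈ Icc U₁ U₂, F (-s) U + U * (1 - m) ≤ energyDensityTT' t s U (2 - m) := by
  intro s hs U hU
  have h := hF (-s) (neg_mem_Icc_of_mem_Icc_neg hs) U hU
  rw [energyDensityTT'_particleHole t s (hU₁.trans hU.1) (n := 2 - m) (by linarith) (by linarith), sub_sub_cancel]
  linarith

/-- **REFLECTED PRESSURE ANCHOR.** A ceiling `p(β_h; t, s, U; m) ≤ P(s, U)` on `[s₁, s₂] × [U₁, U₂]` (`β_h ≥ 0`, `U₁ ≥ 0`, `0 < m < 2`) is the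
ceiling `p(β_h; t, s, U; 2 − m) ≤ P(−s, U) + β_h·U·(m − 1)` on `[−s₂, −s₁] × [U₁, U₂]`. [cite: LiebWuPhysicaA2003, §1 eq. (3)] -/
theorem reflected_anchor (t : ℝ) {s₁ s₂ U₁ U₂ m βh : ℝ} (hβh : 0 ≤ βh) (hU₁ : 0 ≤ U₁) (hm0 : 0 < m) (hm2 : m < 2)
    {P : ℝ → ℝ → ℝ} (hP : ∀ s ∈ Icc s₁ s₂, ∀ U ∈ Icc U₁ U₂, pressureTT' βh t s U m ≤ P s U) :
    ∀ s ∈ Icc (-s₂) (-s₁), ∀ U ∈ Icc U₁ U₂, pressureTT' βh t s U (2 - m) ≤ P (-s) U + βh * U * (m - 1) := by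
  intro s hs U hU
  have h := hP (-s) (neg_mem_Icc_of_mem_Icc_neg hs) U hU
  rw [pressureTT'_particleHole hβh t s (hU₁.trans hU.1) (n := 2 - m) (by linarith) (by linarith), sub_sub_cancel]
  linarith

/-! ## §3 Reflected laws: source hypotheses on `[s₁, s₂]`, conclusion on `[−s₂, −s₁]` for the pair `(2 − n₂, 2 − n₁)` -/

/-- **`T = 0` PS EXCLUSION ON THE MIRRORED CELL from source bound functions.** Hypotheses exactly as `ps_not_groundState_mix_on_cell_of_fns`
(cell `[s₁, s₂] × [U₁, U₂]`, `U₁ ≥ 0`, `n₁ < n₂`, weights `a + b = 1`, cap `C` at `a n₁ + b n₂`, floors `F₁, F₂`, positive margin);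
conclusion: on `[−s₂, −s₁] × [U₁, U₂]` no mixture of translation-invariant states of densities `≤ 2 − n₂` and `≥ 2 − n₁` is a ground state.
[cite: LiebWuPhysicaA2003, §1 eq. (3)] [cite: Israel1979, Thm. I.2.4] [cite: EmeryKivelsonLin1990, pp. 475–476] -/
theorem ps_not_groundState_mix_on_cell_of_fns_reflected (t : ℝ) {s₁ s₂ U₁ U₂ n₁ n₂ a b : ℝ} (hU₁ : 0 ≤ U₁)
    (hn : n₁ < n₂) (ha : 0 ≤ a) (hb : 0 ≤ b) (hab : a + b = 1) {C F₁ F₂ : ℝ → ℝ → ℝ}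
    (hC : ∀ s ∈ Icc s₁ s₂, ∀ U ∈ Icc U₁ U₂, energyDensityTT' t s U (a * n₁ + b * n₂) ≤ C s U)
    (hF₁ : ∀ s ∈ Icc s₁ s₂, ∀ U ∈ Icc U₁ U₂, F₁ s U ≤ energyDensityTT' t s U n₁)
    (hF₂ : ∀ s ∈ Icc s₁ s₂, ∀ U ∈ Icc U₁ U₂, F₂ s U ≤ energyDensityTT' t s U n₂)
    (hpos : ∀ s ∈ Icc s₁ s₂, ∀ U ∈ Icc U₁ U₂, C s U < a * F₁ s U + b * F₂ s U)
    {s : ℝ} (hs : s ∈ Icc (-s₂) (-s₁)) {U : ℝ} (hU : U ∈ Icc U₁ U₂)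
    {ω₁ ω₂ : InfVolFermionState 2} (h₁ : ω₁.IsTranslationInvariant) (h₂ : ω₂.IsTranslationInvariant)
    (hρ₁ : 0 < ω₁.density) (hρ₁' : ω₁.density ≤ 2 - n₂) (hρ₂ : 2 - n₁ ≤ ω₂.density) (hρ₂' : ω₂.density < 2)
    {lam : ℝ} (hl0 : 0 < lam) (hl1 : lam < 1) :
    energyDensityTT' t s U (mix lam hl0.le hl1.le ω₁ ω₂).density <
      (mix lam hl0.le hl1.le ω₁ ω₂).meanEnergy (hubbardTTPrimeFermionInteraction t s U) 1 :=
  ps_not_groundState_mix_particleHole_on_cell t hU₁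
    (fun _ hs' _ hU' _ _ k₁ k₂ a' b' c' d' _ hl0' hl1' =>
      ps_not_groundState_mix_on_cell_of_fns t hU₁ hn ha hb hab hC hF₁ hF₂ hpos hs' hU' k₁ k₂ a' b' c' d' hl0' hl1')
    hs hU h₁ h₂ hρ₁ hρ₁' hρ₂ hρ₂' hl0 hl1

/-- **`T > 0` THERMAL PS EXCLUSION ON THE MIRRORED CELL (`2 log 2` allowance).** Hypotheses exactly as `psT_not_thermal_mix_on_cell_of_fns` with
`0 < n₁` (cap / floor functions on the source cell `[s₁, s₂] × [U₁, U₂]`, `2 log 2 < β·(aF₁ + bF₂ − C)` there); conclusion: at every `(s, U)` of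
`[−s₂, −s₁] × [U₁, U₂]` no mixture of translation-invariant states of densities `≤ 2 − n₂`, `≥ 2 − n₁` is a canonical thermal torus-limit state at
`(β; t, s, U; n)`, any `0 < n < 2` (the margin is particle–hole invariant). [cite: LiebWuPhysicaA2003, §1 eq. (3)] [cite: Israel1979, Thm. I.2.4] [cite: Ruelle1969, §3.3] -/
theorem psT_not_thermal_mix_on_cell_of_fns_reflected (t : ℝ) {s₁ s₂ U₁ U₂ n₁ n₂ a b β : ℝ} (hU₁ : 0 ≤ U₁) (hβ : 0 < β)
    (hn₁ : 0 < n₁) (hn : n₁ < n₂) (hn₂ : n₂ < 2) (ha : 0 ≤ a) (hb : 0 ≤ b) (hab : a + b = 1) {C F₁ F₂ : ℝ → ℝ → ℝ}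
    (hC : ∀ s ∈ Icc s₁ s₂, ∀ U ∈ Icc U₁ U₂, energyDensityTT' t s U (a * n₁ + b * n₂) ≤ C s U)
    (hF₁ : ∀ s ∈ Icc s₁ s₂, ∀ U ∈ Icc U₁ U₂, F₁ s U ≤ energyDensityTT' t s U n₁)
    (hF₂ : ∀ s ∈ Icc s₁ s₂, ∀ U ∈ Icc U₁ U₂, F₂ s U ≤ energyDensityTT' t s U n₂)
    (hpos : ∀ s ∈ Icc s₁ s₂, ∀ U ∈ Icc U₁ U₂, 2 * Real.log 2 < β * (a * F₁ s U + b * F₂ s U - C s U))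
    {s : ℝ} (hs : s ∈ Icc (-s₂) (-s₁)) {U : ℝ} (hU : U ∈ Icc U₁ U₂)
    {ω₁ ω₂ : InfVolFermionState 2} (h₁ : ω₁.IsTranslationInvariant) (h₂ : ω₂.IsTranslationInvariant)
    (hρ₁ : 0 < ω₁.density) (hρ₁' : ω₁.density ≤ 2 - n₂) (hρ₂ : 2 - n₁ ≤ ω₂.density) (hρ₂' : ω₂.density < 2)
    {n : ℝ} (hn0 : 0 < n) (hn2 : n < 2) {lam : ℝ} (hl0 : 0 < lam) (hl1 : lam < 1) {Ls : ℕ → ℕ}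
    (hLs : Tendsto Ls atTop atTop) :
    ¬ (mix lam hl0.le hl1.le ω₁ ω₂).IsTorusLimitOfMixture (sectorGibbsCount n) (fun L => sectorGibbsWeightTT' β t s U n L)
      (fun L => sectorGibbsVectorTT' t s U n L) Ls := by
  have hm0 : 0 < a * n₁ + b * n₂ := by nlinarith
  have hm2 : a * n₁ + b * n₂ < 2 := by nlinarith
  refine psT_not_thermal_mix_on_cell_of_fns t (s₁ := -s₂) (s₂ := -s₁) (n₁ := 2 - n₂) (n₂ := 2 - n₁) (a := b) (b := a)
    hU₁ hβ (by linarith) (by linarith) (by linarith) hb ha (by linarith)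
    (C := fun s U => C (-s) U + U * (b * (2 - n₂) + a * (2 - n₁) - 1))
    (F₁ := fun s U => F₂ (-s) U + U * (1 - n₂)) (F₂ := fun s U => F₁ (-s) U + U * (1 - n₁))
    (reflected_cap t hU₁ hab hm0 hm2 hC) (reflected_floor t hU₁ (hn₁.trans hn) hn₂ hF₂)
    (reflected_floor t hU₁ hn₁ (hn.trans hn₂) hF₁) ?_ hs hU h₁ h₂ hρ₁ hρ₁' hρ₂ hρ₂' hn0 hn2 hl0 hl1 hLs
  intro s' hs' U' hU'
  have h := hpos (-s') (neg_mem_Icc_of_mem_Icc_neg hs') U' hU'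
  have hb1 : b = 1 - a := by linarith
  subst hb1
  linarith

/-- **`T > 0` THERMAL PS EXCLUSION ON THE MIRRORED CELL, HOT ANCHORS (functions).** Hypotheses exactly as
`psT_not_thermal_mix_on_cell_of_fns_hotAnchorFn` with `0 < n₁` (cap / floors / pressure-ceiling FUNCTIONS `P₁(s,U) ≥ p(β_{h,1}; n₁)`,
`P₂(s,U) ≥ p(β_{h,2}; n₂)` on the source cell, anchored inequality there); conclusion on the mirrored cell `[−s₂, −s₁] × [U₁, U₂]` for the pair
«(≤ 2 − n₂ ∣ ≥ 2 − n₁)» at the same `β` (the anchored combination `aP₁ + bP₂ + β_{h,1}aF₁ + β_{h,2}bF₂` and the margin are particle–hole invariant: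
`p(β_h; t, s, U; 2 − m) = β_hU(m − 1) + p(β_h; t, −s, U; m)`). [cite: LiebWuPhysicaA2003, §1 eq. (3)] [cite: Israel1979, Thm. I.2.4] [cite: PoulinHastings2011, eqs. (3)–(8)] -/
theorem psT_not_thermal_mix_on_cell_of_fns_hotAnchorFn_reflected (t : ℝ) {s₁ s₂ U₁ U₂ n₁ n₂ a b β βh₁ βh₂ : ℝ} (hU₁ : 0 ≤ U₁)
    (hβ : 0 < β) (hn₁ : 0 < n₁) (hn : n₁ < n₂) (hn₂ : n₂ < 2) (ha : 0 ≤ a) (hb : 0 ≤ b) (hab : a + b = 1)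
    (hβh₁ : 0 ≤ βh₁) (hβh₂ : 0 ≤ βh₂) (hle₁ : βh₁ ≤ β) (hle₂ : βh₂ ≤ β) {C F₁ F₂ P₁ P₂ : ℝ → ℝ → ℝ}
    (hC : ∀ s ∈ Icc s₁ s₂, ∀ U ∈ Icc U₁ U₂, energyDensityTT' t s U (a * n₁ + b * n₂) ≤ C s U)
    (hF₁ : ∀ s ∈ Icc s₁ s₂, ∀ U ∈ Icc U₁ U₂, F₁ s U ≤ energyDensityTT' t s U n₁)
    (hF₂ : ∀ s ∈ Icc s₁ s₂, ∀ U ∈ Icc U₁ U₂, F₂ s U ≤ energyDensityTT' t s U n₂)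
    (hπ₁ : ∀ s ∈ Icc s₁ s₂, ∀ U ∈ Icc U₁ U₂, pressureTT' βh₁ t s U n₁ ≤ P₁ s U)
    (hπ₂ : ∀ s ∈ Icc s₁ s₂, ∀ U ∈ Icc U₁ U₂, pressureTT' βh₂ t s U n₂ ≤ P₂ s U)
    (hpos : ∀ s ∈ Icc s₁ s₂, ∀ U ∈ Icc U₁ U₂,
      a * P₁ s U + b * P₂ s U + βh₁ * (a * F₁ s U) + βh₂ * (b * F₂ s U) < β * (a * F₁ s U + b * F₂ s U - C s U))
    {s : ℝ} (hs : s ∈ Icc (-s₂) (-s₁)) {U : ℝ} (hU : U ∈ Icc U₁ U₂)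
    {ω₁ ω₂ : InfVolFermionState 2} (h₁ : ω₁.IsTranslationInvariant) (h₂ : ω₂.IsTranslationInvariant)
    (hρ₁ : 0 < ω₁.density) (hρ₁' : ω₁.density ≤ 2 - n₂) (hρ₂ : 2 - n₁ ≤ ω₂.density) (hρ₂' : ω₂.density < 2)
    {n : ℝ} (hn0 : 0 < n) (hn2 : n < 2) {lam : ℝ} (hl0 : 0 < lam) (hl1 : lam < 1) {Ls : ℕ → ℕ}
    (hLs : Tendsto Ls atTop atTop) :
    ¬ (mix lam hl0.le hl1.le ω₁ ω₂).IsTorusLimitOfMixture (sectorGibbsCount n) (fun L => sectorGibbsWeightTT' β t s U n L)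
      (fun L => sectorGibbsVectorTT' t s U n L) Ls := by
  have hm0 : 0 < a * n₁ + b * n₂ := by nlinarith
  have hm2 : a * n₁ + b * n₂ < 2 := by nlinarith
  refine psT_not_thermal_mix_on_cell_of_fns_hotAnchorFn t (s₁ := -s₂) (s₂ := -s₁) (n₁ := 2 - n₂) (n₂ := 2 - n₁)
    (a := b) (b := a) hU₁ hβ (by linarith) (by linarith) (by linarith) hb ha (by linarith) hβh₂ hβh₁ hle₂ hle₁
    (C := fun s U => C (-s) U + U * (b * (2 - n₂) + a * (2 - n₁) - 1))
    (F₁ := fun s U => F₂ (-s) U + U * (1 - n₂)) (F₂ := fun s U => F₁ (-s) U + U * (1 - n₁))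
    (P₁ := fun s U => P₂ (-s) U + βh₂ * U * (n₂ - 1)) (P₂ := fun s U => P₁ (-s) U + βh₁ * U * (n₁ - 1))
    (reflected_cap t hU₁ hab hm0 hm2 hC) (reflected_floor t hU₁ (hn₁.trans hn) hn₂ hF₂)
    (reflected_floor t hU₁ hn₁ (hn.trans hn₂) hF₁) (reflected_anchor t hβh₂ hU₁ (hn₁.trans hn) hn₂ hπ₂)
    (reflected_anchor t hβh₁ hU₁ hn₁ (hn.trans hn₂) hπ₁) ?_ hs hU h₁ h₂ hρ₁ hρ₁' hρ₂ hρ₂' hn0 hn2 hl0 hl1 hLs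
  intro s' hs' U' hU'
  have h := hpos (-s') (neg_mem_Icc_of_mem_Icc_neg hs') U' hU'
  have hb1 : b = 1 - a := by linarith
  subst hb1
  linarith

/-- **`μ` AXIS, `T = 0`: THE SAME CELL-UNIFORM CHEMICAL-POTENTIAL GAP ON THE MIRRORED CELL.** Hypotheses exactly as `psGC_gap_on_cell_of_fns`
(source cell, cell-uniform margin `g ≤ aF₁ + bF₂ − C`); conclusion: at every `(s, U)` of `[−s₂, −s₁] × [U₁, U₂]`, if `μ₁` carries a
translation-invariant ground state of `H(t,s,U) − μ₁N` (any `Γ₁` with `e_{Γ₁} = e_Φ − μ₁ρ`) of density `≤ 2 − n₂` and `μ₂` one of density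
`≥ 2 − n₁`, then `a·b·(n₂ − n₁)·(μ₂ − μ₁) ≥ g` — the electron-doped side has the gap of its hole-doped particle–hole image.
[cite: LiebWuPhysicaA2003, §1 eq. (3)] [cite: Israel1979, Thm. I.2.4] [cite: Ruelle1969, §3.4] -/
theorem psGC_gap_on_cell_of_fns_reflected (t : ℝ) {s₁ s₂ U₁ U₂ n₁ n₂ a b g : ℝ} (hU₁ : 0 ≤ U₁) (hn₁ : 0 < n₁) (hn : n₁ < n₂)
    (hn₂ : n₂ < 2) (ha : 0 ≤ a) (hb : 0 ≤ b) (hab : a + b = 1) {C F₁ F₂ : ℝ → ℝ → ℝ}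
    (hC : ∀ s ∈ Icc s₁ s₂, ∀ U ∈ Icc U₁ U₂, energyDensityTT' t s U (a * n₁ + b * n₂) ≤ C s U)
    (hF₁ : ∀ s ∈ Icc s₁ s₂, ∀ U ∈ Icc U₁ U₂, F₁ s U ≤ energyDensityTT' t s U n₁)
    (hF₂ : ∀ s ∈ Icc s₁ s₂, ∀ U ∈ Icc U₁ U₂, F₂ s U ≤ energyDensityTT' t s U n₂)
    (hg : ∀ s ∈ Icc s₁ s₂, ∀ U ∈ Icc U₁ U₂, g ≤ a * F₁ s U + b * F₂ s U - C s U)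
    {s : ℝ} (hs : s ∈ Icc (-s₂) (-s₁)) {U : ℝ} (hU : U ∈ Icc U₁ U₂)
    {Γ₁ Γ₂ : FermionInteraction 2} {R₁ R₂ μ₁ μ₂ : ℝ} {ω₁ ω₂ : InfVolFermionState 2}
    (hω₁ : ω₁.IsMeanEnergyMinimiser Γ₁ R₁)
    (hΓ₁ : ∀ σ : InfVolFermionState 2, σ.meanEnergy Γ₁ R₁ = σ.meanEnergy (hubbardTTPrimeFermionInteraction t s U) 1 - μ₁ * σ.density)
    (hω₂ : ω₂.IsMeanEnergyMinimiser Γ₂ R₂)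
    (hΓ₂ : ∀ σ : InfVolFermionState 2, σ.meanEnergy Γ₂ R₂ = σ.meanEnergy (hubbardTTPrimeFermionInteraction t s U) 1 - μ₂ * σ.density)
    (hρ₁ : ω₁.density ≤ 2 - n₂) (hρ₂ : 2 - n₁ ≤ ω₂.density) :
    g ≤ a * b * (n₂ - n₁) * (μ₂ - μ₁) := by
  have hm0 : 0 < a * n₁ + b * n₂ := by nlinarith
  have hm2 : a * n₁ + b * n₂ < 2 := by nlinarith
  have h := psGC_gap_on_cell_of_fns t (s₁ := -s₂) (s₂ := -s₁) (n₁ := 2 - n₂) (n₂ := 2 - n₁) (a := b) (b := a) (g := g)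
    hU₁ (by linarith) (by linarith) (by linarith) hb ha (by linarith)
    (C := fun s U => C (-s) U + U * (b * (2 - n₂) + a * (2 - n₁) - 1))
    (F₁ := fun s U => F₂ (-s) U + U * (1 - n₂)) (F₂ := fun s U => F₁ (-s) U + U * (1 - n₁))
    (reflected_cap t hU₁ hab hm0 hm2 hC) (reflected_floor t hU₁ (hn₁.trans hn) hn₂ hF₂)
    (reflected_floor t hU₁ hn₁ (hn.trans hn₂) hF₁) ?_ hs hU hω₁ hΓ₁ hω₂ hΓ₂ hρ₁ hρ₂
  · linarith
  · intro s' hs' U' hU'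
    have h := hg (-s') (neg_mem_Icc_of_mem_Icc_neg hs') U' hU'
    have hb1 : b = 1 - a := by linarith
    subst hb1
    linarith

/-- **`μ` AXIS, `T > 0`: NO `(β, μ)` CARRIES BOTH PHASES ON THE MIRRORED CELL (hot-anchor FUNCTIONS).** Hypotheses exactly as
`psGCT_not_equilibrium_on_cell_of_fns_hotAnchorFn` on the source cell; conclusion: at every `(s, U)` of `[−s₂, −s₁] × [U₁, U₂]` and every `μ`, if
`H(t,s,U) − μN` (any `Γ` with `e_Γ = e_Φ − μρ`) has a variational equilibrium at `β` of density `≤ 2 − n₂`, it has none of density `≥ 2 − n₁`.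
[cite: LiebWuPhysicaA2003, §1 eq. (3)] [cite: Israel1979, Thm. I.2.4] [cite: PoulinHastings2011, eqs. (3)–(8)] -/
theorem psGCT_not_equilibrium_on_cell_of_fns_hotAnchorFn_reflected (t : ℝ) {s₁ s₂ U₁ U₂ n₁ n₂ a b β βh₁ βh₂ : ℝ}
    (hU₁ : 0 ≤ U₁) (hβ : 0 < β) (hn₁ : 0 < n₁) (hn : n₁ < n₂) (hn₂ : n₂ < 2) (ha : 0 ≤ a) (hb : 0 ≤ b) (hab : a + b = 1)
    (hβh₁ : 0 ≤ βh₁) (hβh₂ : 0 ≤ βh₂) (hle₁ : βh₁ ≤ β) (hle₂ : βh₂ ≤ β) {C F₁ F₂ P₁ P₂ : ℝ → ℝ → ℝ}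
    (hC : ∀ s ∈ Icc s₁ s₂, ∀ U ∈ Icc U₁ U₂, energyDensityTT' t s U (a * n₁ + b * n₂) ≤ C s U)
    (hF₁ : ∀ s ∈ Icc s₁ s₂, ∀ U ∈ Icc U₁ U₂, F₁ s U ≤ energyDensityTT' t s U n₁)
    (hF₂ : ∀ s ∈ Icc s₁ s₂, ∀ U ∈ Icc U₁ U₂, F₂ s U ≤ energyDensityTT' t s U n₂)
    (hπ₁ : ∀ s ∈ Icc s₁ s₂, ∀ U ∈ Icc U₁ U₂, pressureTT' βh₁ t s U n₁ ≤ P₁ s U)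
    (hπ₂ : ∀ s ∈ Icc s₁ s₂, ∀ U ∈ Icc U₁ U₂, pressureTT' βh₂ t s U n₂ ≤ P₂ s U)
    (hM : ∀ s ∈ Icc s₁ s₂, ∀ U ∈ Icc U₁ U₂,
      a * P₁ s U + b * P₂ s U + βh₁ * (a * F₁ s U) + βh₂ * (b * F₂ s U) < β * (a * F₁ s U + b * F₂ s U - C s U))
    {s : ℝ} (hs : s ∈ Icc (-s₂) (-s₁)) {U : ℝ} (hU : U ∈ Icc U₁ U₂)
    {Γ : FermionInteraction 2} {R' μ : ℝ} {ω₁ ω₂ : InfVolFermionState 2} (hω₁ : ω₁.IsVarEquilibrium β Γ R')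
    (hΓ : ∀ σ : InfVolFermionState 2, σ.meanEnergy Γ R' = σ.meanEnergy (hubbardTTPrimeFermionInteraction t s U) 1 - μ * σ.density)
    (hρ₁ : ω₁.density ≤ 2 - n₂) (hρ₂ : 2 - n₁ ≤ ω₂.density) :
    ¬ ω₂.IsVarEquilibrium β Γ R' := by
  have hm0 : 0 < a * n₁ + b * n₂ := by nlinarith
  have hm2 : a * n₁ + b * n₂ < 2 := by nlinarith
  refine psGCT_not_equilibrium_on_cell_of_fns_hotAnchorFn t (s₁ := -s₂) (s₂ := -s₁) (n₁ := 2 - n₂) (n₂ := 2 - n₁)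
    (a := b) (b := a) hU₁ hβ (by linarith) (by linarith) (by linarith) hb ha (by linarith) hβh₂ hβh₁ hle₂ hle₁
    (C := fun s U => C (-s) U + U * (b * (2 - n₂) + a * (2 - n₁) - 1))
    (F₁ := fun s U => F₂ (-s) U + U * (1 - n₂)) (F₂ := fun s U => F₁ (-s) U + U * (1 - n₁))
    (P₁ := fun s U => P₂ (-s) U + βh₂ * U * (n₂ - 1)) (P₂ := fun s U => P₁ (-s) U + βh₁ * U * (n₁ - 1))
    (reflected_cap t hU₁ hab hm0 hm2 hC) (reflected_floor t hU₁ (hn₁.trans hn) hn₂ hF₂)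
    (reflected_floor t hU₁ hn₁ (hn.trans hn₂) hF₁) (reflected_anchor t hβh₂ hU₁ (hn₁.trans hn) hn₂ hπ₂)
    (reflected_anchor t hβh₁ hU₁ hn₁ (hn.trans hn₂) hπ₁) ?_ hs hU hω₁ hΓ hρ₁ hρ₂
  intro s' hs' U' hU'
  have h := hM (-s') (neg_mem_Icc_of_mem_Icc_neg hs') U' hU'
  have hb1 : b = 1 - a := by linarith
  subst hb1
  linarith

/-- **`μ` AXIS, `T > 0`: THE CELL-UNIFORM GAP ON THE MIRRORED CELL (hot-anchor FUNCTIONS, threshold `β ≥ β₀`).** Hypotheses exactly as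
`psGCT_gap_on_cell_of_fns_hotAnchorFn` on the source cell; conclusion: at every `(s, U)` of `[−s₂, −s₁] × [U₁, U₂]`, every `β ≥ β₀`: if `μ₁`
carries a variational equilibrium of `H(t,s,U) − μ₁N` of density `≤ 2 − n₂` and `μ₂` one of density `≥ 2 − n₁`, then `a·b·(n₂ − n₁)·(μ₂ − μ₁) ≥ g`.
[cite: LiebWuPhysicaA2003, §1 eq. (3)] [cite: Israel1979, Thm. I.2.4] [cite: Ruelle1969, §3.4] [cite: PoulinHastings2011, eqs. (3)–(8)] -/
theorem psGCT_gap_on_cell_of_fns_hotAnchorFn_reflected (t : ℝ) {s₁ s₂ U₁ U₂ n₁ n₂ a b β₀ βh₁ βh₂ g : ℝ} (hU₁ : 0 ≤ U₁)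
    (hβ₀pos : 0 < β₀) (hn₁ : 0 < n₁) (hn : n₁ < n₂) (hn₂ : n₂ < 2) (ha : 0 ≤ a) (hb : 0 ≤ b) (hab : a + b = 1)
    (hβh₁ : 0 ≤ βh₁) (hβh₂ : 0 ≤ βh₂) (h0₁ : βh₁ ≤ β₀) (h0₂ : βh₂ ≤ β₀) {C F₁ F₂ P₁ P₂ : ℝ → ℝ → ℝ}
    (hC : ∀ s ∈ Icc s₁ s₂, ∀ U ∈ Icc U₁ U₂, energyDensityTT' t s U (a * n₁ + b * n₂) ≤ C s U)
    (hF₁ : ∀ s ∈ Icc s₁ s₂, ∀ U ∈ Icc U₁ U₂, F₁ s U ≤ energyDensityTT' t s U n₁)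
    (hF₂ : ∀ s ∈ Icc s₁ s₂, ∀ U ∈ Icc U₁ U₂, F₂ s U ≤ energyDensityTT' t s U n₂)
    (hπ₁ : ∀ s ∈ Icc s₁ s₂, ∀ U ∈ Icc U₁ U₂, pressureTT' βh₁ t s U n₁ ≤ P₁ s U)
    (hπ₂ : ∀ s ∈ Icc s₁ s₂, ∀ U ∈ Icc U₁ U₂, pressureTT' βh₂ t s U n₂ ≤ P₂ s U)
    (hgM : ∀ s ∈ Icc s₁ s₂, ∀ U ∈ Icc U₁ U₂, g ≤ a * F₁ s U + b * F₂ s U - C s U)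
    (hN : ∀ s ∈ Icc s₁ s₂, ∀ U ∈ Icc U₁ U₂,
      a * P₁ s U + b * P₂ s U + βh₁ * (a * F₁ s U) + βh₂ * (b * F₂ s U) ≤ β₀ * (a * F₁ s U + b * F₂ s U - C s U - g))
    {s : ℝ} (hs : s ∈ Icc (-s₂) (-s₁)) {U : ℝ} (hU : U ∈ Icc U₁ U₂) {β : ℝ} (hβ : β₀ ≤ β)
    {Γ₁ Γ₂ : FermionInteraction 2} {R₁ R₂ μ₁ μ₂ : ℝ} {ω₁ ω₂ : InfVolFermionState 2}
    (hω₁ : ω₁.IsVarEquilibrium β Γ₁ R₁)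
    (hΓ₁ : ∀ σ : InfVolFermionState 2, σ.meanEnergy Γ₁ R₁ = σ.meanEnergy (hubbardTTPrimeFermionInteraction t s U) 1 - μ₁ * σ.density)
    (hω₂ : ω₂.IsVarEquilibrium β Γ₂ R₂)
    (hΓ₂ : ∀ σ : InfVolFermionState 2, σ.meanEnergy Γ₂ R₂ = σ.meanEnergy (hubbardTTPrimeFermionInteraction t s U) 1 - μ₂ * σ.density)
    (hρ₁ : ω₁.density ≤ 2 - n₂) (hρ₂ : 2 - n₁ ≤ ω₂.density) :
    g ≤ a * b * (n₂ - n₁) * (μ₂ - μ₁) := by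
  have hm0 : 0 < a * n₁ + b * n₂ := by nlinarith
  have hm2 : a * n₁ + b * n₂ < 2 := by nlinarith
  have h := psGCT_gap_on_cell_of_fns_hotAnchorFn t (s₁ := -s₂) (s₂ := -s₁) (n₁ := 2 - n₂) (n₂ := 2 - n₁) (a := b) (b := a)
    (g := g) hU₁ hβ₀pos (by linarith) (by linarith) (by linarith) hb ha (by linarith) hβh₂ hβh₁ h0₂ h0₁
    (C := fun s U => C (-s) U + U * (b * (2 - n₂) + a * (2 - n₁) - 1))
    (F₁ := fun s U => F₂ (-s) U + U * (1 - n₂)) (F₂ := fun s U => F₁ (-s) U + U * (1 - n₁))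
    (P₁ := fun s U => P₂ (-s) U + βh₂ * U * (n₂ - 1)) (P₂ := fun s U => P₁ (-s) U + βh₁ * U * (n₁ - 1))
    (reflected_cap t hU₁ hab hm0 hm2 hC) (reflected_floor t hU₁ (hn₁.trans hn) hn₂ hF₂)
    (reflected_floor t hU₁ hn₁ (hn.trans hn₂) hF₁) (reflected_anchor t hβh₂ hU₁ (hn₁.trans hn) hn₂ hπ₂)
    (reflected_anchor t hβh₁ hU₁ hn₁ (hn.trans hn₂) hπ₁) ?_ ?_ hs hU hβ hω₁ hΓ₁ hω₂ hΓ₂ hρ₁ hρ₂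
  · linarith
  · intro s' hs' U' hU'
    have h := hgM (-s') (neg_mem_Icc_of_mem_Icc_neg hs') U' hU'
    have hb1 : b = 1 - a := by linarith
    subst hb1
    linarith
  · intro s' hs' U' hU'
    have h := hN (-s') (neg_mem_Icc_of_mem_Icc_neg hs') U' hU'
    have hb1 : b = 1 - a := by linarith
    subst hb1
    linarith

end Summit.Ventures.CertifiedManyBodySolver.Observables

end
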